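import Summits.SmoothPoincare4.SmoothPoincare4.Theorems.SblfDescentSblfExists
import Summits.SmoothPoincare4.SmoothPoincare4.Theorems.SblfDescentStepTwoStubSblfTransport
import Literature.Topology.FourManifolds.GenusOneSblfOnSphereFourProofs

/-!
# `SblfExists` (support of route SblfDescent): the UNCONDITIONAL shield
# `SmoothPoincare4 → SblfExists`

Item `stmt-SmoothPoincare4-18530` (`Summit.SmoothPoincare4.SmoothPoincare4.Theses.SblfDescent.SblfExists`:
every smooth homotopy 4-sphere carries a simplified broken Lefschetz fibration with non-empty round
locus, of some lower genus `h`).  The item is closed in the tree MODULO the named fact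
`Literature.Topology.FourManifolds.exists_isSimplifiedBrokenLefschetzFibration` (Baykur–Saeki 2017,
Cor. 6.2; bridge `sblfExists_of_exists_isSimplifiedBrokenLefschetzFibration`, reading `sblfExists_iff`
in `SblfDescentSblfExists.lean`).  This file records the OTHER direction of its status, now without
any hypothesis: since the tree PROVES that the round unit sphere `S⁴ ⊆ ℝ⁵` carries the
Auroux–Donaldson–Katzarkov genus-one fibration
(`Literature.Topology.FourManifolds.exists_sblf_genus_one_noLefschetz_sphere_four_holds`, an explicit
real-algebraic model `S⁴ → S²` with one fold circle, torus / sphere fibres and no Lefschetz point) and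
that simplified broken Lefschetz fibrations pull back along diffeomorphisms (`sblf_comp_diffeomorph`),

* `exists_sblf_zero_of_diffeomorph_sphere_four` — every smooth 4-manifold DIFFEOMORPHIC to `S⁴`
  carries a genus-one SBLF with empty Lefschetz set (tree form `IsSimplifiedBrokenLefschetzFibration o
  f ∅ 0`), unconditionally;
* `sblfExists_of_smoothPoincare4` — `SmoothPoincare4 → SblfExists`, unconditionally: under the summit
  every smooth homotopy 4-sphere is diffeomorphic to `S⁴`, so it carries the transported ADK
  fibration (`h = 0`, `L = ∅`);
* `not_smoothPoincare4_of_not_sblfExists` — contrapositive: **any refutation of the item is a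
  disproof of the smooth 4-dimensional Poincaré conjecture** (a counterexample `M` is a smooth
  homotopy 4-sphere without SBLFs, hence not diffeomorphic to `S⁴`);
* `sblfExists_iff_smoothPoincare4_of_descent` — given the route's other three items (`RungOne`,
  `StepTwo`, `StepGE3`) the support is EQUIVALENT to the summit (`→` is the route's deciding theorem
  `SblfDescent.closes`, `←` the shield).

So the item is TRUE in print (Baykur–Saeki), unrefutable short of an exotic `S⁴` (this file), and its
only missing piece in the tree is the discharge `exists_isSimplifiedBrokenLefschetzFibration_holds` of
the named fact — nothing on the summit side.  No new mathematics: composition of three landed results.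
-/

noncomputable section

-- the prescribed namespace `Summit.<P>.<Sub>.…` duplicates `SmoothPoincare4` (P = Sub)
set_option linter.dupNamespace false

open scoped Manifold ContDiff Topology ContinuousMap
open Literature.Topology.FourManifolds

namespace Summit.SmoothPoincare4.SmoothPoincare4.Theorems

/-- **Every smooth 4-manifold diffeomorphic to `S⁴` carries a genus-one simplified broken Lefschetz
fibration with non-empty round locus and no Lefschetz point** — unconditionally.  Pull the tree's
explicit Auroux–Donaldson–Katzarkov fibration of the round sphere
(`exists_sblf_genus_one_noLefschetz_sphere_four_holds`) back along the diffeomorphism `Φ`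
(`sblf_comp_diffeomorph`: orientation `Φ^* o`, map `f ∘ Φ`, Lefschetz set `Φ⁻¹ ∅ = ∅`).
[cite: AurouxDonaldsonKatzarkov2005, §8.2 Example 1] -/
theorem exists_sblf_zero_of_diffeomorph_sphere_four (M : Type) [TopologicalSpace M]
    [ChartedSpace (EuclideanSpace ℝ (Fin 4)) M] [IsManifold (𝓡 4) ∞ M]
    (Φ : M ≃ₘ⟮𝓡 4, 𝓡 4⟯ Metric.sphere (0 : EuclideanSpace ℝ (Fin 5)) 1) :
    ∃ (o : SmoothOrientation (𝓡 4) M) (f : M → Metric.sphere (0 : EuclideanSpace ℝ (Fin 3)) 1),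
      IsSimplifiedBrokenLefschetzFibration o f ∅ 0 := by
  obtain ⟨o, f, hf⟩ := exists_sblf_genus_one_noLefschetz_sphere_four_holds
  refine ⟨o.comap Φ (by simp), f ∘ Φ, ?_⟩
  simpa only [Finset.preimage_empty] using sblf_comp_diffeomorph Φ hf

/-- **The shield: `SmoothPoincare4 → SblfExists`, unconditionally.**  Under the summit a smooth
homotopy 4-sphere `M` is diffeomorphic to `S⁴`, hence carries the transported ADK fibration
(`exists_sblf_zero_of_diffeomorph_sphere_four`, lower genus `0`, empty Lefschetz set); repack the
tree structure into the route's inline clauses with `sblfExists_iff`.  In particular the hypothesis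
`SblfExists` of the route's deciding theorem is implied by its conclusion: it is load-bearing for the
METHOD (it supplies the rung the descent starts from), never an extra truth condition. [folklore] -/
theorem sblfExists_of_smoothPoincare4 (hS : _root_.SmoothPoincare4) :
    Summit.SmoothPoincare4.SmoothPoincare4.Theses.SblfDescent.SblfExists := by
  refine sblfExists_iff.mpr ?_
  intro M _ _ _ _ _ e
  obtain ⟨Φ⟩ := hS M ‹_› ‹_› e
  obtain ⟨o, f, hf⟩ := exists_sblf_zero_of_diffeomorph_sphere_four M Φ
  exact ⟨o, f, ∅, 0, hf⟩

/-- **A refutation of `SblfExists` is a disproof of the smooth 4-dimensional Poincaré conjecture**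
(contrapositive of `sblfExists_of_smoothPoincare4`, unconditional): a smooth homotopy 4-sphere
without any simplified broken Lefschetz fibration is not diffeomorphic to `S⁴`.  So no degenerate,
finite or junk witness can kill the item; only an exotic `S⁴` can. [folklore] -/
theorem not_smoothPoincare4_of_not_sblfExists
    (h : ¬ Summit.SmoothPoincare4.SmoothPoincare4.Theses.SblfDescent.SblfExists) :
    ¬ _root_.SmoothPoincare4 :=
  fun hS => h (sblfExists_of_smoothPoincare4 hS)

/-- **Given the route's other items the support is equivalent to the summit.**  With `RungOne`,
`StepTwo` and `StepGE3` in hand, `SblfExists ↔ SmoothPoincare4`: `→` is the route's deciding theorem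
`SblfDescent.closes` (ℕ-induction on the lower genus), `←` is the unconditional shield
`sblfExists_of_smoothPoincare4`. [folklore] -/
theorem sblfExists_iff_smoothPoincare4_of_descent
    (h1 : Summit.SmoothPoincare4.SmoothPoincare4.Theses.SblfDescent.RungOne)
    (h2 : Summit.SmoothPoincare4.SmoothPoincare4.Theses.SblfDescent.StepTwo)
    (h3 : Summit.SmoothPoincare4.SmoothPoincare4.Theses.SblfDescent.StepGE3) :
    Summit.SmoothPoincare4.SmoothPoincare4.Theses.SblfDescent.SblfExists ↔ _root_.SmoothPoincare4 :=
  ⟨fun hex => Summit.SmoothPoincare4.SmoothPoincare4.Theses.SblfDescent.closes hex h1 h2 h3,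
    sblfExists_of_smoothPoincare4⟩

end Summit.SmoothPoincare4.SmoothPoincare4.Theorems

end
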